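import Summits.BirchSwinnertonDyer.Rank1Residual.Additive.X4RankZeroKatoBoundTamagawaExact
import Summits.BirchSwinnertonDyer.Rank1Residual.Additive.X4RankZeroVisibleRefinedCertificateSharpSocketsTwoPaid
import HarnessLib

/-!
# The (G) visibility ENDs and record sockets over the TAMAGAWA-EXACT Kato reading A161″ — NO
# Tamagawa binder, NO parametrisation datum, NO parity binder
# (cell `b2b-bsdres`, team n1011, row T-GSHARP FILE 7; seat p04 GEN 12; the `_of_katoTam` twins of FILE 5 /
# FILE 6-sockets / T-GSHARP FILES 2–4; lit-kato GEN 25's signed cross-walk `UTAM-CROSSWALK-gen25.md`)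

HONEST FRAMING (cell `b2b-bsdres`, run/shared/lean/b2b/bsd-rank1-residual/, verbatim in every
file): the goal of the cell is to DELETE the COMBINATION-SHAPED residual classes of the
Birch–Swinnerton-Dyer formula for ALL analytic-rank `≤ 1` elliptic curves over `ℚ` — "full BSD
formula for every rank `≤ 1` curve in class `C`" assembled STRICTLY from published theorems — so
that the rank-`≤ 1` remainder becomes exactly the CONSTRUCTION-SHAPED classes, which are TYPED
(missing-input `Prop`s), NOT attempted. This is not "finishing BSD". Team n1011 (N10 / N11, the
additive block X4 ∧ `p = 3`): research route on the CONSTRUCTION-SHAPED class X4; no claim beyond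
the stated classes; nothing is booked; no mark / label / count is changed by this file. Theorems
only (no definition, no new named fact, no `sorry`). END theorems / sockets: CONDITIONAL on the
displayed named facts (the Tamagawa-exact Kato reading A161″ `hKatoT`, Cassels–Tate `hCT`,
Gross–Zagier–Kolyvagin `hGZK`, modularity `hmod`, Tate uniformisation A40/A41 `hU`/`hU2`); they CLOSE
NOTHING by themselves — a per-row RECORD discharges `θ`, the partner's rank budget, the place list and
every disjunct of `hplaces` (resp. `hloc`) in the kernel and carries `hr`, `hq`/`hv`, `hrank` as
EVIDENCE binders (n1011 lead R5-82 (d)).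

## What

A161″ (`Kato2004.rankZero_padicValNat_sha_add_padicValNat_tamagawa_le_of_additive_potGood_of_imageContainsSL2`,
lit-kato GEN 24, p320328: `ord_p #Ш(p) + v_p(Tam E) ≤ ord_p(L(E,1)/Ω)`) makes the (G) upper half
EXACTLY the BSD upper half in rank `0`, so the Tamagawa prices of the earlier (G) ENDs — `¬ 3 ∣ ∏ c_ℓ`
(FILE 5/6), the READING / DEFECT `≤ 1` + `hev` (T-GSHARP FILES 1–4) — and the parametrisation datum
`D`/`hc` all disappear. This file restates each (G) visibility END / socket of the row with those
binders DELETED and `hKato ↦ hKatoT` (binder ORDER otherwise token for token, generated from the tree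
texts by substitution; tail = FILE 6's `X4RankZero.bsdp_of_missingLowerBoundAt_of_katoTam`):
* `X4RankZero.bsdp_three_of_congr_of_places₇_of_katoTam` — the refined seven-kind END (`S ⊇ T`);
* `X4RankZero.bsdp_three_of_congr_of_places₇_of_katoTam_of_primeList_paidThree` — record socket, the
  place `3` PAID (the D44 / PASS / PASS⁺ (G) rows);
* `X4RankZero.bsdp_three_of_congr_of_places₇_of_katoTam_of_primeList_paidThreeAndAt` — two paid places;
* `X4RankZero.bsdp_of_congr_of_rank_two_of_katoTam[_of_primeList]` — p03's rank-two certificate /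
  p18's prime-list adapter, every odd `p` (the K42 / K43 / PASS-rank (G) rows).
EVIDENCE (census `HOME/b2b-bsdres-n1011-p04/gen12/census/gsharp_defect_rows.tsv`): at `p = 3` every
potentially good N11 visibility row with `3 ∣ ∏ c_ℓ` (526) is served on the upper side; the located gap
of route planner 1's ST-51c shrinks to the 2 rows with `ord₃ #Ш_an = 4` (lower side). Nothing booked.

References: [CremonaMazur2000] §3 and Table 1; [AgasheStein2002] Thm. 3.1; [Kato2004Asterisque]
Thm. 14.5 (3), Prop. 14.16 (2), §14.8; [GreenbergLNM1716] §4 Prop. 4.13, §3 Lemma 3.3;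
[SilvermanAEC2009] VII.5.1, X.4.14; [SilvermanATAEC1994] Ch. V; [Miller2011LMS] Def. 1.1.
-/

set_option autoImplicit false

noncomputable section

open scoped Classical NumberField
open IsDedekindDomain NumberField WeierstrassCurve Rat.HeightOneSpectrum
  Literature.NumberTheory.EllipticCurves Literature.NumberTheory.EllipticCurves.ModularForms
  Literature.NumberTheory.EllipticCurves.Rank1Residual
  Literature.NumberTheory.EllipticCurves.Rank1Residual.Typed
  Literature.NumberTheory.GaloisRepresentations
  Summit.BirchSwinnertonDyer.Rank1Residual.GaloisImage

namespace Summit.BirchSwinnertonDyer.Rank1Residual.Additive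

/-- **X4 ∧ `r = 0`, potentially GOOD at `3`, `ord₃ #Ш_an ≤ 2`: `BSD(E,3)` from the TAMAGAWA-EXACT
Kato upper half A161″ and a VISIBLE element of `Ш(E)[3]` from the REFINED seven-kind certificate — NO
Tamagawa binder, NO parametrisation datum, NO parity binder** (FILE 5's
`X4RankZero.bsdp_three_of_congr_of_places₇_of_kato` binder list with `hKato ↦ hKatoT` and `htam`, `D`,
`hc` DELETED): pay `#E′(ℚ_w)[3]·#(ℤ_w/3)` on `T` against `hT`, every place of `S ∖ T` free of kind
(i), (ii), (iii), (iv′), (vi), (iii′) or (vii); lower half `Visible.missingLowerBoundAt_three_of_congr_of_places₇`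
(T-2LL FILE 3), upper half FILE 6's `X4RankZero.bsdp_of_missingLowerBoundAt_of_katoTam`. Conditional on
`hKatoT`, `hCT`, `hGZK`, `hmod`, `hU`, `hU2`; closes nothing until a record discharges the certificate.
[cite: CremonaMazur2000, §3 and Table 1] [cite: AgasheStein2002, Thm. 3.1]
[cite: Kato2004Asterisque, Thm. 14.5 (3) (p. 236), Prop. 14.16 (2) (p. 244), §14.8 (p. 238)]
[cite: GreenbergLNM1716, §4 Prop. 4.13] [cite: SilvermanAEC2009, Thm. X.4.14] -/
theorem X4RankZero.bsdp_three_of_congr_of_places₇_of_katoTam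
    (hKatoT : Kato2004.rankZero_padicValNat_sha_add_padicValNat_tamagawa_le_of_additive_potGood_of_imageContainsSL2)
    (hCT : exists_casselsTate_pairing (K := ℚ))
    (hGZK : rank_eq_analyticRank_of_analyticRank_le_one) (hmod : hasEntireLFunction_rat)
    (W : WeierstrassCurve ℚ) [W.IsElliptic] [W.IsGloballyMinimal]
    (hr : W.analyticRank = 0) (hX : haveI : Fact (Nat.Prime 3) := ⟨Nat.prime_three⟩; ClassX4 W 3)
    (hpot : 0 ≤ padicValRat 3 W.j)
    (hsurj : ∀ n : ℕ, W.HasSurjectiveModNGaloisRep (3 ^ n : ℕ))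
    {q : ℚ} (hq : shaAn W = (q : ℂ)) (hv : padicValRat 3 q ≤ 2)
    (hU : Silverman1994_thmV53_tateUniformisation.{0})
    (hU2 : Silverman1994_thmV53_corV54_tateUniformisation.{0})
    (W' : WeierstrassCurve ℚ) [W'.IsElliptic]
    (θ : geomTorsion W' ((3 : ℕ) : ℤ) ≃+ geomTorsion W ((3 : ℕ) : ℤ))
    (hθ : ∀ (σ : Field.absoluteGaloisGroup ℚ) (P : geomTorsion W' ((3 : ℕ) : ℤ)),
      θ (σ • P) = σ • θ P)
    (S T : Finset (HeightOneSpectrum (𝓞 ℚ))) (hTS : T ⊆ S)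
    (hS : ∀ w : HeightOneSpectrum (𝓞 ℚ), w ∉ S →
      W.HasGoodReductionAt w ∧ W'.HasGoodReductionAt w ∧ ((3 : ℕ) : 𝓞 ℚ) ∉ w.asIdeal)
    (hT : (∏ w ∈ T, Nat.card (nsmulAddMonoidHom 3 :
        (W'.baseChange (w.adicCompletion ℚ)).toAffine.Point →+ _).ker *
        Nat.card (w.adicCompletionIntegers ℚ ⧸
          Ideal.span {((3 : ℕ) : w.adicCompletionIntegers ℚ)})) < 3 ^ W'.mordellWeilRank)
    (hplaces : ∀ w ∈ S, w ∉ T →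
      (((3 : ℕ) : 𝓞 ℚ) ∉ w.asIdeal ∧ Nat.card (nsmulAddMonoidHom 3 :
          (W'.baseChange (w.adicCompletion ℚ)).toAffine.Point →+ _).ker = 1) ∨
      (W.HasSplitMultiplicativeReductionAt w ∧ W'.HasSplitMultiplicativeReductionAt w ∧
        Nat.card (nsmulAddMonoidHom 3 :
          (W.baseChange (w.adicCompletion ℚ)).toAffine.Point →+ _).ker ≤ 3) ∨
      (W.HasMultiplicativeReductionAt w ∧ W'.HasMultiplicativeReductionAt w ∧
        (∃ r : w.adicCompletion ℚ, algebraMap ℚ (w.adicCompletion ℚ) (-(W.c₄ / W.c₆)) =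
          r ^ 2 * algebraMap ℚ (w.adicCompletion ℚ) (-(W'.c₄ / W'.c₆))) ∧
        (∀ ζ : w.adicCompletion ℚ, ζ ^ 3 = 1 → ζ = 1)) ∨
      (W.HasMultiplicativeReductionAt w ∧
        ¬ IsSquare (algebraMap ℚ (w.adicCompletion ℚ) (-(W.c₄ / W.c₆))) ∧
        W'.HasGoodReductionAt w ∧ ((3 : ℕ) : 𝓞 ℚ) ∉ w.asIdeal) ∨
      (W.HasGoodReductionAt w ∧ W'.HasMultiplicativeReductionAt w ∧
        ¬ IsSquare (algebraMap ℚ (w.adicCompletion ℚ) (-(W'.c₄ / W'.c₆))) ∧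
        ((3 : ℕ) : 𝓞 ℚ) ∉ w.asIdeal) ∨
      (1 < w.valuation ℚ W.j ∧ 1 < w.valuation ℚ W'.j ∧
        (∃ r : w.adicCompletion ℚ, algebraMap ℚ (w.adicCompletion ℚ) (-(W.c₄ / W.c₆)) =
          r ^ 2 * algebraMap ℚ (w.adicCompletion ℚ) (-(W'.c₄ / W'.c₆))) ∧
        (∀ ζ : w.adicCompletion ℚ, ζ ^ 3 = 1 → ζ = 1)) ∨
      (W.HasAdditiveReductionAt w ∧ W'.HasAdditiveReductionAt w ∧ ((3 : ℕ) : 𝓞 ℚ) ∉ w.asIdeal ∧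
        Nat.card (nsmulAddMonoidHom 3 :
          (W'.baseChange (w.adicCompletion ℚ)).toAffine.Point →+ _).ker = 3)) :
    haveI : Fact (Nat.Prime 3) := ⟨Nat.prime_three⟩
    BSDp W 3 := by
  haveI : Fact (Nat.Prime 3) := ⟨Nat.prime_three⟩
  have hfin : Finite W.toAffine.Point := finite_point_of_analyticRank_eq_zero W hGZK hr
  have hirr : Irr W 3 :=
    hasIrreducibleModPGaloisRep_of_hasSurjectiveModNGaloisRep W 3 (by simpa using hsurj 1)
  have hSha : W.ShaFinite := (hGZK W (by rw [hr]; exact zero_le_one)).2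
  have hlow : MissingLowerBoundAt W 3 :=
    Visible.missingLowerBoundAt_three_of_congr_of_places₇ hU hU2 hCT W W' θ hθ S T hTS hS hfin
      (coprime_natCard_point_of_irr W 3 hirr) hT hplaces hSha hq hv
  exact X4RankZero.bsdp_of_missingLowerBoundAt_of_katoTam W 3 hKatoT hGZK hmod hr hX hpot hsurj hlow

/-- **Record socket, potentially GOOD rows, TAMAGAWA-EXACT Kato A161″, the place `3` PAID, prime-list
form — NO Tamagawa binder, NO parametrisation datum, NO parity binder** (FILE 6's
`…_of_kato_of_primeList_paidThree` binder order with `hKato ↦ hKatoT` and `htam`, `{N} [NeZero N] D hc`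
DELETED — a records generator drops three displayed binders and changes one token): serves EVERY
potentially good visibility row with a seven-kind certificate and `ord₃ #Ш_an ≤ 2`, whatever its Tamagawa
numbers (census: all 526 N11 rows with `3 ∣ ∏c_ℓ` but the 2 with `ord₃ #Ш_an = 4`).
[cite: CremonaMazur2000, §3 and Table 1] [cite: AgasheStein2002, Thm. 3.1]
[cite: Kato2004Asterisque, Thm. 14.5 (3) (p. 236), Prop. 14.16 (2) (p. 244), §14.8 (p. 238)]
[cite: GreenbergLNM1716, §4 Prop. 4.13] [cite: SilvermanAEC2009, Thm. X.4.14] -/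
theorem X4RankZero.bsdp_three_of_congr_of_places₇_of_katoTam_of_primeList_paidThree
    (hKatoT : Kato2004.rankZero_padicValNat_sha_add_padicValNat_tamagawa_le_of_additive_potGood_of_imageContainsSL2)
    (hCT : exists_casselsTate_pairing (K := ℚ))
    (hGZK : rank_eq_analyticRank_of_analyticRank_le_one) (hmod : hasEntireLFunction_rat)
    (hU : Silverman1994_thmV53_tateUniformisation.{0})
    (hU2 : Silverman1994_thmV53_corV54_tateUniformisation.{0})
    (W : WeierstrassCurve ℚ) [W.IsElliptic] [W.IsGloballyMinimal]
    (hr : W.analyticRank = 0) (hX : haveI : Fact (Nat.Prime 3) := ⟨Nat.prime_three⟩; ClassX4 W 3)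
    (hpot : 0 ≤ padicValRat 3 W.j)
    (hsurj : ∀ n : ℕ, W.HasSurjectiveModNGaloisRep (3 ^ n : ℕ))
    {q : ℚ} (hq : shaAn W = (q : ℂ)) (hv : padicValRat 3 q ≤ 2)
    (W' : WeierstrassCurve ℚ) [W'.IsElliptic]
    (θ : geomTorsion W' ((3 : ℕ) : ℤ) ≃+ geomTorsion W ((3 : ℕ) : ℤ))
    (hθ : ∀ (σ : Field.absoluteGaloisGroup ℚ) (P : geomTorsion W' ((3 : ℕ) : ℤ)),
      θ (σ • P) = σ • θ P)
    {t k : ℕ} (htors₃ : ∀ w : HeightOneSpectrum (𝓞 ℚ), (primesEquiv w : ℕ) = 3 →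
      Nat.card (nsmulAddMonoidHom 3 :
        (W'.baseChange (w.adicCompletion ℚ)).toAffine.Point →+ _).ker ≤ t)
    (hbudget : 3 * t < 3 ^ k) (hrank : k ≤ W'.mordellWeilRank)
    {E₀ F₀ : WeierstrassCurve ℤ} (hE : E₀.map (Int.castRingHom ℚ) = W)
    (hF : F₀.map (Int.castRingHom ℚ) = W') (L : List ℕ) (h3L : 3 ∈ L)
    (hΔE : ∀ q : ℕ, q.Prime → (q : ℤ) ∣ E₀.Δ → q ∈ L)
    (hΔF : ∀ q : ℕ, q.Prime → (q : ℤ) ∣ F₀.Δ → q ∈ L)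
    (hplaces : ∀ w : HeightOneSpectrum (𝓞 ℚ), (primesEquiv w : ℕ) ∈ L → (primesEquiv w : ℕ) ≠ 3 →
      (((3 : ℕ) : 𝓞 ℚ) ∉ w.asIdeal ∧ Nat.card (nsmulAddMonoidHom 3 :
          (W'.baseChange (w.adicCompletion ℚ)).toAffine.Point →+ _).ker = 1) ∨
      (W.HasSplitMultiplicativeReductionAt w ∧ W'.HasSplitMultiplicativeReductionAt w ∧
        Nat.card (nsmulAddMonoidHom 3 :
          (W.baseChange (w.adicCompletion ℚ)).toAffine.Point →+ _).ker ≤ 3) ∨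
      (W.HasMultiplicativeReductionAt w ∧ W'.HasMultiplicativeReductionAt w ∧
        (∃ r : w.adicCompletion ℚ, algebraMap ℚ (w.adicCompletion ℚ) (-(W.c₄ / W.c₆)) =
          r ^ 2 * algebraMap ℚ (w.adicCompletion ℚ) (-(W'.c₄ / W'.c₆))) ∧
        (∀ ζ : w.adicCompletion ℚ, ζ ^ 3 = 1 → ζ = 1)) ∨
      (W.HasMultiplicativeReductionAt w ∧
        ¬ IsSquare (algebraMap ℚ (w.adicCompletion ℚ) (-(W.c₄ / W.c₆))) ∧
        W'.HasGoodReductionAt w ∧ ((3 : ℕ) : 𝓞 ℚ) ∉ w.asIdeal) ∨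
      (W.HasGoodReductionAt w ∧ W'.HasMultiplicativeReductionAt w ∧
        ¬ IsSquare (algebraMap ℚ (w.adicCompletion ℚ) (-(W'.c₄ / W'.c₆))) ∧
        ((3 : ℕ) : 𝓞 ℚ) ∉ w.asIdeal) ∨
      (1 < w.valuation ℚ W.j ∧ 1 < w.valuation ℚ W'.j ∧
        (∃ r : w.adicCompletion ℚ, algebraMap ℚ (w.adicCompletion ℚ) (-(W.c₄ / W.c₆)) =
          r ^ 2 * algebraMap ℚ (w.adicCompletion ℚ) (-(W'.c₄ / W'.c₆))) ∧
        (∀ ζ : w.adicCompletion ℚ, ζ ^ 3 = 1 → ζ = 1)) ∨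
      (W.HasAdditiveReductionAt w ∧ W'.HasAdditiveReductionAt w ∧ ((3 : ℕ) : 𝓞 ℚ) ∉ w.asIdeal ∧
        Nat.card (nsmulAddMonoidHom 3 :
          (W'.baseChange (w.adicCompletion ℚ)).toAffine.Point →+ _).ker = 3)) :
    haveI : Fact (Nat.Prime 3) := ⟨Nat.prime_three⟩
    BSDp W 3 := by
  haveI : Fact (Nat.Prime 3) := ⟨Nat.prime_three⟩
  obtain ⟨S, hS⟩ := exists_placeFinset_of_primeList L
  obtain ⟨T, hTS, hT, hT3⟩ := exists_paidPlace_three W' L h3L hS htors₃ hbudget hrank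
  exact X4RankZero.bsdp_three_of_congr_of_places₇_of_katoTam hKatoT hCT hGZK hmod W hr hX hpot hsurj
    hq hv hU hU2 W' θ hθ S T hTS
    (good_and_not_mem_of_not_mem_placeFinset hE hF L Nat.prime_three h3L hΔE hΔF hS) hT
    (fun w hw hwT ↦ hplaces w ((hS w).mp hw) (hT3 w hw hwT))

/-- **Record socket, potentially GOOD rows, TAMAGAWA-EXACT Kato A161″, TWO paid places `3` and `ℓ ≠ 3`**
(FILE 3's `…_of_kato_of_primeList_paidThreeAndAt` with the same deletions; the three rank-3 `d1→T` rows
of the D44 road). [cite: CremonaMazur2000, §3 and Table 1] [cite: AgasheStein2002, Thm. 3.1]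
[cite: Kato2004Asterisque, Thm. 14.5 (3) (p. 236), Prop. 14.16 (2) (p. 244), §14.8 (p. 238)]
[cite: GreenbergLNM1716, §4 Prop. 4.13] [cite: SilvermanAEC2009, Thm. X.4.14] -/
theorem X4RankZero.bsdp_three_of_congr_of_places₇_of_katoTam_of_primeList_paidThreeAndAt
    (hKatoT : Kato2004.rankZero_padicValNat_sha_add_padicValNat_tamagawa_le_of_additive_potGood_of_imageContainsSL2)
    (hCT : exists_casselsTate_pairing (K := ℚ))
    (hGZK : rank_eq_analyticRank_of_analyticRank_le_one) (hmod : hasEntireLFunction_rat)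
    (hU : Silverman1994_thmV53_tateUniformisation.{0})
    (hU2 : Silverman1994_thmV53_corV54_tateUniformisation.{0})
    (W : WeierstrassCurve ℚ) [W.IsElliptic] [W.IsGloballyMinimal]
    (hr : W.analyticRank = 0) (hX : haveI : Fact (Nat.Prime 3) := ⟨Nat.prime_three⟩; ClassX4 W 3)
    (hpot : 0 ≤ padicValRat 3 W.j)
    (hsurj : ∀ n : ℕ, W.HasSurjectiveModNGaloisRep (3 ^ n : ℕ))
    {q : ℚ} (hq : shaAn W = (q : ℂ)) (hv : padicValRat 3 q ≤ 2)
    (W' : WeierstrassCurve ℚ) [W'.IsElliptic]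
    (θ : geomTorsion W' ((3 : ℕ) : ℤ) ≃+ geomTorsion W ((3 : ℕ) : ℤ))
    (hθ : ∀ (σ : Field.absoluteGaloisGroup ℚ) (P : geomTorsion W' ((3 : ℕ) : ℤ)),
      θ (σ • P) = σ • θ P)
    (ℓ : ℕ) (hℓ : ℓ.Prime) (hℓ3 : ℓ ≠ 3)
    {t u k : ℕ} (htors₃ : ∀ w : HeightOneSpectrum (𝓞 ℚ), (primesEquiv w : ℕ) = 3 →
      Nat.card (nsmulAddMonoidHom 3 :
        (W'.baseChange (w.adicCompletion ℚ)).toAffine.Point →+ _).ker ≤ t)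
    (htorsℓ : ∀ w : HeightOneSpectrum (𝓞 ℚ), (primesEquiv w : ℕ) = ℓ →
      Nat.card (nsmulAddMonoidHom 3 :
        (W'.baseChange (w.adicCompletion ℚ)).toAffine.Point →+ _).ker ≤ u)
    (hbudget : 3 * t * u < 3 ^ k) (hrank : k ≤ W'.mordellWeilRank)
    {E₀ F₀ : WeierstrassCurve ℤ} (hE : E₀.map (Int.castRingHom ℚ) = W)
    (hF : F₀.map (Int.castRingHom ℚ) = W') (L : List ℕ) (h3L : 3 ∈ L) (hℓL : ℓ ∈ L)
    (hΔE : ∀ q : ℕ, q.Prime → (q : ℤ) ∣ E₀.Δ → q ∈ L)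
    (hΔF : ∀ q : ℕ, q.Prime → (q : ℤ) ∣ F₀.Δ → q ∈ L)
    (hplaces : ∀ w : HeightOneSpectrum (𝓞 ℚ), (primesEquiv w : ℕ) ∈ L → (primesEquiv w : ℕ) ≠ 3 →
      (primesEquiv w : ℕ) ≠ ℓ →
      (((3 : ℕ) : 𝓞 ℚ) ∉ w.asIdeal ∧ Nat.card (nsmulAddMonoidHom 3 :
          (W'.baseChange (w.adicCompletion ℚ)).toAffine.Point →+ _).ker = 1) ∨
      (W.HasSplitMultiplicativeReductionAt w ∧ W'.HasSplitMultiplicativeReductionAt w ∧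
        Nat.card (nsmulAddMonoidHom 3 :
          (W.baseChange (w.adicCompletion ℚ)).toAffine.Point →+ _).ker ≤ 3) ∨
      (W.HasMultiplicativeReductionAt w ∧ W'.HasMultiplicativeReductionAt w ∧
        (∃ r : w.adicCompletion ℚ, algebraMap ℚ (w.adicCompletion ℚ) (-(W.c₄ / W.c₆)) =
          r ^ 2 * algebraMap ℚ (w.adicCompletion ℚ) (-(W'.c₄ / W'.c₆))) ∧
        (∀ ζ : w.adicCompletion ℚ, ζ ^ 3 = 1 → ζ = 1)) ∨
      (W.HasMultiplicativeReductionAt w ∧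
        ¬ IsSquare (algebraMap ℚ (w.adicCompletion ℚ) (-(W.c₄ / W.c₆))) ∧
        W'.HasGoodReductionAt w ∧ ((3 : ℕ) : 𝓞 ℚ) ∉ w.asIdeal) ∨
      (W.HasGoodReductionAt w ∧ W'.HasMultiplicativeReductionAt w ∧
        ¬ IsSquare (algebraMap ℚ (w.adicCompletion ℚ) (-(W'.c₄ / W'.c₆))) ∧
        ((3 : ℕ) : 𝓞 ℚ) ∉ w.asIdeal) ∨
      (1 < w.valuation ℚ W.j ∧ 1 < w.valuation ℚ W'.j ∧
        (∃ r : w.adicCompletion ℚ, algebraMap ℚ (w.adicCompletion ℚ) (-(W.c₄ / W.c₆)) =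
          r ^ 2 * algebraMap ℚ (w.adicCompletion ℚ) (-(W'.c₄ / W'.c₆))) ∧
        (∀ ζ : w.adicCompletion ℚ, ζ ^ 3 = 1 → ζ = 1)) ∨
      (W.HasAdditiveReductionAt w ∧ W'.HasAdditiveReductionAt w ∧ ((3 : ℕ) : 𝓞 ℚ) ∉ w.asIdeal ∧
        Nat.card (nsmulAddMonoidHom 3 :
          (W'.baseChange (w.adicCompletion ℚ)).toAffine.Point →+ _).ker = 3)) :
    haveI : Fact (Nat.Prime 3) := ⟨Nat.prime_three⟩
    BSDp W 3 := by
  haveI : Fact (Nat.Prime 3) := ⟨Nat.prime_three⟩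
  obtain ⟨S, hS⟩ := exists_placeFinset_of_primeList L
  obtain ⟨T, hTS, hT, hT3⟩ :=
    exists_paidPlaces_three_and W' L h3L ℓ hℓ hℓL hℓ3 hS htors₃ htorsℓ hbudget hrank
  exact X4RankZero.bsdp_three_of_congr_of_places₇_of_katoTam hKatoT hCT hGZK hmod W hr hX hpot hsurj
    hq hv hU hU2 W' θ hθ S T hTS
    (good_and_not_mem_of_not_mem_placeFinset hE hF L Nat.prime_three h3L hΔE hΔF hS) hT
    (fun w hw hwT ↦ hplaces w ((hS w).mp hw) (hT3 w hw hwT).1 (hT3 w hw hwT).2)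

/-- **X4 ∧ `r = 0`, potentially GOOD at an odd `p`, `ord_p #Ш_an ≤ 2`: `BSD(E,p)` from the
TAMAGAWA-EXACT Kato upper half A161″ and a VISIBLE element of `Ш(E)[p]` supplied by a `p`-congruent curve
of rank `≥ 2`** — n1011-p03's `X4RankZero.bsdp_of_congr_of_rank_two_of_kato` binder list with
`hKato ↦ hKatoT` and `htam`, `D`, `hc` DELETED; tail FILE 6's `X4RankZero.bsdp_of_missingLowerBoundAt_of_katoTam`.
[cite: CremonaMazur2000, §3 and Table 1] [cite: AgasheStein2002, Thm. 3.1]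
[cite: Kato2004Asterisque, Thm. 14.5 (3) (p. 236), Prop. 14.16 (2) (p. 244), §14.8 (p. 238)]
[cite: GreenbergLNM1716, §4 Prop. 4.13] [cite: SilvermanAEC2009, Thm. X.4.14] -/
theorem X4RankZero.bsdp_of_congr_of_rank_two_of_katoTam
    (hKatoT : Kato2004.rankZero_padicValNat_sha_add_padicValNat_tamagawa_le_of_additive_potGood_of_imageContainsSL2)
    (hCT : exists_casselsTate_pairing (K := ℚ))
    (hGZK : rank_eq_analyticRank_of_analyticRank_le_one) (hmod : hasEntireLFunction_rat)
    (W : WeierstrassCurve ℚ) [W.IsElliptic] [W.IsGloballyMinimal] (p : ℕ) [Fact p.Prime] (hp : p ≠ 2)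
    (hr : W.analyticRank = 0) (hX : ClassX4 W p) (hpot : 0 ≤ padicValRat p W.j)
    (hsurj : ∀ n : ℕ, W.HasSurjectiveModNGaloisRep (p ^ n : ℕ))
    {q : ℚ} (hq : shaAn W = (q : ℂ)) (hv : padicValRat p q ≤ 2)
    (W' : WeierstrassCurve ℚ) [W'.IsElliptic]
    (θ : geomTorsion W' (p : ℤ) ≃+ geomTorsion W (p : ℤ))
    (hθ : ∀ (σ : Field.absoluteGaloisGroup ℚ) (P : geomTorsion W' (p : ℤ)), θ (σ • P) = σ • θ P)
    (hrank : 2 ≤ W'.mordellWeilRank) (S : Finset (HeightOneSpectrum (𝓞 ℚ)))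
    (hS : ∀ v : HeightOneSpectrum (𝓞 ℚ), v ∉ S →
      W.HasGoodReductionAt v ∧ W'.HasGoodReductionAt v ∧ (p : 𝓞 ℚ) ∉ v.asIdeal)
    (hloc : ∀ v ∈ S, Nat.card (nsmulAddMonoidHom p :
      (W'.baseChange (v.adicCompletion ℚ)).toAffine.Point →+ _).ker = 1) :
    BSDp W p := by
  haveI : Finite W.toAffine.Point := finite_point_of_analyticRank_eq_zero W hGZK hr
  have hirr : Irr W p :=
    hasIrreducibleModPGaloisRep_of_hasSurjectiveModNGaloisRep W p (by simpa using hsurj 1)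
  have hrank' : Module.finrank ℚ ℚ + 1 ≤ W'.mordellWeilRank := by rwa [Module.finrank_self]
  have hvis := W.exists_sha_ne_zero_of_congr_of_rank W' hp θ hθ S hS ‹_›
    (coprime_natCard_point_of_irr W p hirr) hrank' hloc
  have hlow : MissingLowerBoundAt W p :=
    missingLowerBoundAt_of_casselsTate_of_pow_dvd W p hCT (hGZK W (by omega)).2 hq (k := 1)
      (by simpa using hv) (by simpa using dvd_shaOrder_of_exists_torsion W p hvis)
  exact X4RankZero.bsdp_of_missingLowerBoundAt_of_katoTam W p hKatoT hGZK hmod hr hX hpot hsurj hlow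

/-- **`X4RankZero.bsdp_of_congr_of_rank_two_of_katoTam` with `S` = the places over a prime list
`L ∋ p`** (n1011-p18's adapter shape with the same deletions). [cite: SilvermanAEC2009, VII.5 Prop. 5.1(a)]
[cite: Kato2004Asterisque, Thm. 14.5 (3) (p. 236), Prop. 14.16 (2) (p. 244), §14.8 (p. 238)]
[cite: GreenbergLNM1716, §4 Prop. 4.13] -/
theorem X4RankZero.bsdp_of_congr_of_rank_two_of_katoTam_of_primeList
    (hKatoT : Kato2004.rankZero_padicValNat_sha_add_padicValNat_tamagawa_le_of_additive_potGood_of_imageContainsSL2)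
    (hCT : exists_casselsTate_pairing (K := ℚ))
    (hGZK : rank_eq_analyticRank_of_analyticRank_le_one) (hmod : hasEntireLFunction_rat)
    (W : WeierstrassCurve ℚ) [W.IsElliptic] [W.IsGloballyMinimal] (p : ℕ) [Fact p.Prime] (hp : p ≠ 2)
    (hr : W.analyticRank = 0) (hX : ClassX4 W p) (hpot : 0 ≤ padicValRat p W.j)
    (hsurj : ∀ n : ℕ, W.HasSurjectiveModNGaloisRep (p ^ n : ℕ))
    {q : ℚ} (hq : shaAn W = (q : ℂ)) (hv : padicValRat p q ≤ 2)
    (W' : WeierstrassCurve ℚ) [W'.IsElliptic]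
    (θ : geomTorsion W' (p : ℤ) ≃+ geomTorsion W (p : ℤ))
    (hθ : ∀ (σ : Field.absoluteGaloisGroup ℚ) (P : geomTorsion W' (p : ℤ)), θ (σ • P) = σ • θ P)
    (hrank : 2 ≤ W'.mordellWeilRank)
    {E₀ F₀ : WeierstrassCurve ℤ} (hE : E₀.map (Int.castRingHom ℚ) = W)
    (hF : F₀.map (Int.castRingHom ℚ) = W') (L : List ℕ) (hpL : p ∈ L)
    (hΔE : ∀ q : ℕ, q.Prime → (q : ℤ) ∣ E₀.Δ → q ∈ L)
    (hΔF : ∀ q : ℕ, q.Prime → (q : ℤ) ∣ F₀.Δ → q ∈ L)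
    (hloc : ∀ v : HeightOneSpectrum (𝓞 ℚ), (primesEquiv v : ℕ) ∈ L →
      Nat.card (nsmulAddMonoidHom p :
        (W'.baseChange (v.adicCompletion ℚ)).toAffine.Point →+ _).ker = 1) :
    BSDp W p := by
  obtain ⟨S, hS⟩ := exists_placeFinset_of_primeList L
  exact X4RankZero.bsdp_of_congr_of_rank_two_of_katoTam hKatoT hCT hGZK hmod W p hp hr hX hpot hsurj
    hq hv W' θ hθ hrank S
    (good_and_not_mem_of_not_mem_placeFinset hE hF L (Fact.out : p.Prime) hpL hΔE hΔF hS)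
    (fun v hvS ↦ hloc v ((hS v).mp hvS))

end Summit.BirchSwinnertonDyer.Rank1Residual.Additive

end
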